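import Summits.HubbardSuperconductivity.Statement
import Literature.MathematicalPhysics.QuantumLattice.DWaveSource

/-!
# Route `VestigialChirality` — STRUCTURAL split glue for the target (stmt-HubbardSuperconductivity-2416)

BC2-redirect of the restated deciding crux `VestigialChirality.Target` (route re-audit 2026-08-17,
crux-strategist `cstrat-stmt-HubbardSuperconductivity-2416`): the typed decomposition

  `ChiralPointDWaveOrder` (stmt-14380)  ∧  `SsbToEvenTorusLRO` (stmt-10439)  ⟹  `Target` (stmt-2416),

stated STRUCTURALLY — the three route declarations are written out as their bodies, verbatim the
`def`s of `Theses/VestigialChirality.lean` rev 4 — so that this module does NOT import the route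
file and can be linked from it (`ledger route edit … --split Target … --glue-by
Summit.HubbardSuperconductivity.HubbardSuperconductivity.Theorems.target_of_chiralPoint_of_ssbTransfer`;
the gate renders `theorem TargetGlueBy_holds : ChiralPointDWaveOrder → SsbToEvenTorusLRO → Target :=
_root_.…` in the route file, which elaborates by δ-unfolding the three `def`s). The same
implication with the route names is the support item `TargetGlue` (stmt-14381), closed by
`Theorems/VestigialChiralityTargetGlue.lean` (`targetGlue_proof`, which imports the route file and
is therefore not linkable as `--glue-by`).

The seam is the Koma–Tasaki interface, not the syntax of `Target`: piece 1 is a CONSTRUCTION at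
ONE weak-coupling point `(U, δ, μ)` — (a) grand-canonical density matching `Re ω₀(N)/(L+1)² → 1-δ`,
(b) infinite-volume-first `d_{x²-y²}` order under a vanishing `B₁g` source `HasDWaveOrder U μ`,
(c) pair-chirality long-range order of every `(N_L, S^z = 0)`-sector ground state; piece 2 is the
TRANSFER over a weak-coupling window — (a) ∧ (b) at `(U, δ, μ)` ⟹ `d_{x²-y²}` pair-field
long-range order of every sector ground-state sequence at `(U, δ)` (the unproved Koma–Tasaki
direction, KT1994 §2.5). Neither piece mentions the other's conclusion; `Target`'s conjunct (ii)
is reached only by feeding the construction's outputs (a), (b) into the transfer at the matched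
point, below BOTH thresholds (`min U₀ U₁`). (The naive cut of `Target` into its two conjuncts is
not a decomposition at all: the conjuncts quantify `∃ U, δ` separately and their conjunction does
not give a common point.)

Sources: T. Koma, H. Tasaki, J. Stat. Phys. 76 (1994) 745, §2.5 (SSB vs LRO; only LRO ⇒ SSB is a
theorem); D. J. Scalapino, Phys. Rep. 250 (1995) 329, §2 eq. (2.4) (the pair-field order
functional); S. Raghu, S. A. Kivelson, D. J. Scalapino, PRB 81 (2010) 224505 §III (the d+id point).
-/

-- the mandated namespace `Summit.<Summit>.<Problem>.Theorems` repeats `HubbardSuperconductivity`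
-- (single-problem summit, D-0017), which the `dupNamespace` linter flags on every declaration
set_option linter.dupNamespace false

namespace Summit.HubbardSuperconductivity.HubbardSuperconductivity.Theorems

open scoped BigOperators Matrix

/-- **Split glue for `VestigialChirality.Target`** (BC2 redirect, strategist 2026-08-17):
`⟦ChiralPointDWaveOrder⟧ → ⟦SsbToEvenTorusLRO⟧ → ⟦Target⟧` with the three route `def`s written out
(bodies verbatim, rev 4). Proof: at `U₀ > 0` take the transfer's window `U₁`, apply the
construction below `min U₀ U₁`; the chiral point `(U, δ, μ, c)` gives conjunct (i) of the target
by its clause (c) and conjunct (ii) by the transfer fed with clauses (a), (b) at `(U, δ, μ)`.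
[cite: KomaTasaki1994, §2.5] [cite: Scalapino1995, §2 eq. (2.4)] -/
theorem target_of_chiralPoint_of_ssbTransfer :
    (∀ U₀ : ℝ, 0 < U₀ → ∃ U ∈ Set.Ioo (0 : ℝ) U₀, ∃ δ ∈ Set.Ioo (0 : ℝ) (1 / 2), ∃ μ c : ℝ, 0 < c ∧ Filter.Tendsto (fun L : ℕ => ((Literature.MathematicalPhysics.QuantumLattice.hubbardTorusWith 2 (L + 1) 1 U μ).groundStateFunctional Literature.MathematicalPhysics.QuantumLattice.totalNumber).re / ((L + 1 : ℕ) : ℝ) ^ 2) Filter.atTop (nhds (1 - δ)) ∧ Literature.MathematicalPhysics.QuantumLattice.HasDWaveOrder U μ ∧ ∀ (N : ℕ → ℕ) (ψ : ∀ L, Literature.MathematicalPhysics.QuantumLattice.Fock (Literature.MathematicalPhysics.QuantumLattice.Orb (Literature.MathematicalPhysics.QuantumLattice.FermionTorus 2 L))), (∀ L, Even L → N L = 2 * ⌊(1 - δ) * (L : ℝ) ^ 2 / 2⌋₊ ∧ star (ψ L) ⬝ᵥ ψ L = 1 ∧ Literature.MathematicalPhysics.QuantumLattice.IsGroundStateInSector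 (Literature.MathematicalPhysics.QuantumLattice.hubbardTorus 2 L 1 U) (N L) 0 (ψ L)) → ∃ L₀ : ℕ, ∀ (L : ℕ) [NeZero L], Even L → L₀ ≤ L → let B := fun (x : Literature.Probability.LatticeModels.TorusSite 2 L) (e : Literature.Probability.LatticeModels.Site 2) => Literature.MathematicalPhysics.QuantumLattice.annihilation (Literature.MathematicalPhysics.QuantumLattice.orb (Literature.MathematicalPhysics.QuantumLattice.FermionTorus.ofTorusSite x) 0) * Literature.MathematicalPhysics.QuantumLattice.annihilation (Literature.MathematicalPhysics.QuantumLattice.orb (Literature.MathematicalPhysics.QuantumLattice.FermionTorus.ofTorusSite (x + Literature.Probability.LatticeModels.Torus.proj L e)) 1) - Literature.MathematicalPhysics.QuantumLattice.annihilation (Literature.MathematicalPhysics.QuantumLattice.orb (Literature.MathematicalPhysics.QuantumLattice.FermionTorus.ofTorusSite x) 1) * Literature.MathematicalPhysics.QuantumLattice.annihilation (Literature.MathematicalPhysics.QuantumLattice.orb (Literature.MathematicalPhysics.QuantumLattice.FermionTorus.ofTorusSite (x + Literature.Probability.LatticeModels.Torus.proj L e)) 0); let P₂ := fun (x : Literature.Probability.LatticeModels.TorusSite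 2 L) => ((1 / Real.sqrt 2 : ℝ) : ℂ) • (B x ![1, 1] + B x ![-1, -1] - B x ![1, -1] - B x ![-1, 1]); let P₁ := fun (x : Literature.Probability.LatticeModels.TorusSite 2 L) => Literature.MathematicalPhysics.QuantumLattice.localPair Literature.MathematicalPhysics.QuantumLattice.dWaveFormFactor L x; let X := ∑ x : Literature.Probability.LatticeModels.TorusSite 2 L, Complex.I • (Matrix.conjTranspose (P₁ x) * P₂ x - Matrix.conjTranspose (P₂ x) * P₁ x); c ≤ (Literature.MathematicalPhysics.QuantumLattice.expect (Matrix.conjTranspose X * X) (ψ L)).re / ((L : ℕ) : ℝ) ^ 4) →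
    (∃ U₀ : ℝ, 0 < U₀ ∧ ∀ U ∈ Set.Ioo (0:ℝ) U₀, ∀ δ ∈ Set.Ioo (0:ℝ) (1 / 2), ∀ μ : ℝ, Filter.Tendsto (fun L : ℕ => ((Literature.MathematicalPhysics.QuantumLattice.hubbardTorusWith 2 (L + 1) 1 U μ).groundStateFunctional Literature.MathematicalPhysics.QuantumLattice.totalNumber).re / ((L + 1 : ℕ) : ℝ) ^ 2) Filter.atTop (nhds (1 - δ)) → Literature.MathematicalPhysics.QuantumLattice.HasDWaveOrder U μ → ∀ (N : ℕ → ℕ) (ψ : ∀ L, Literature.MathematicalPhysics.QuantumLattice.Fock (Literature.MathematicalPhysics.QuantumLattice.Orb (Literature.MathematicalPhysics.QuantumLattice.FermionTorus 2 L))), (∀ L, Even L → N L = 2 * ⌊(1 - δ) * (L : ℝ) ^ 2 / 2⌋₊ ∧ star (ψ L) ⬝ᵥ ψ L = 1 ∧ Literature.MathematicalPhysics.QuantumLattice.IsGroundStateInSector (Literature.MathematicalPhysics.QuantumLattice.hubbardTorus 2 L 1 U) (N L) 0 (ψ L)) → Literature.Probability.LatticeModels.HasLongRangeOrder (fun k =>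 Literature.Probability.LatticeModels.halfOpenBox 2 (2 * k)) (fun k => Literature.MathematicalPhysics.QuantumLattice.torusPullback (Literature.MathematicalPhysics.QuantumLattice.pairFieldCorr Literature.MathematicalPhysics.QuantumLattice.dWaveFormFactor ψ) (2 * k))) →
    (∀ U₀ : ℝ, 0 < U₀ → ∃ U ∈ Set.Ioo (0 : ℝ) U₀, ∃ δ ∈ Set.Ioo (0 : ℝ) (1 / 2), ∃ c : ℝ, 0 < c ∧ ∀ (N : ℕ → ℕ) (ψ : ∀ L, Literature.MathematicalPhysics.QuantumLattice.Fock (Literature.MathematicalPhysics.QuantumLattice.Orb (Literature.MathematicalPhysics.QuantumLattice.FermionTorus 2 L))), (∀ L, Even L → N L = 2 * ⌊(1 - δ) * (L : ℝ) ^ 2 / 2⌋₊ ∧ star (ψ L) ⬝ᵥ ψ L = 1 ∧ Literature.MathematicalPhysics.QuantumLattice.IsGroundStateInSector (Literature.MathematicalPhysics.QuantumLattice.hubbardTorus 2 L 1 U) (N L) 0 (ψ L)) → (∃ L₀ : ℕ, ∀ (L : ℕ) [NeZero L], Even L → L₀ ≤ L → let B := fun (x : Literature.Probability.LatticeModels.TorusSite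 2 L) (e : Literature.Probability.LatticeModels.Site 2) => Literature.MathematicalPhysics.QuantumLattice.annihilation (Literature.MathematicalPhysics.QuantumLattice.orb (Literature.MathematicalPhysics.QuantumLattice.FermionTorus.ofTorusSite x) 0) * Literature.MathematicalPhysics.QuantumLattice.annihilation (Literature.MathematicalPhysics.QuantumLattice.orb (Literature.MathematicalPhysics.QuantumLattice.FermionTorus.ofTorusSite (x + Literature.Probability.LatticeModels.Torus.proj L e)) 1) - Literature.MathematicalPhysics.QuantumLattice.annihilation (Literature.MathematicalPhysics.QuantumLattice.orb (Literature.MathematicalPhysics.QuantumLattice.FermionTorus.ofTorusSite x) 1) * Literature.MathematicalPhysics.QuantumLattice.annihilation (Literature.MathematicalPhysics.QuantumLattice.orb (Literature.MathematicalPhysics.QuantumLattice.FermionTorus.ofTorusSite (x + Literature.Probability.LatticeModels.Torus.proj L e)) 0); let P₂ := fun (x : Literature.Probability.LatticeModels.TorusSite 2 L) => ((1 / Real.sqrt 2 : ℝ) : ℂ) • (B x ![1, 1] + B x ![-1, -1] - B x ![1, -1] - B x ![-1, 1]); let P₁ := fun (x : Literature.Probability.LatticeModels.TorusSite 2 L)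 => Literature.MathematicalPhysics.QuantumLattice.localPair Literature.MathematicalPhysics.QuantumLattice.dWaveFormFactor L x; let X := ∑ x : Literature.Probability.LatticeModels.TorusSite 2 L, Complex.I • (Matrix.conjTranspose (P₁ x) * P₂ x - Matrix.conjTranspose (P₂ x) * P₁ x); c ≤ (Literature.MathematicalPhysics.QuantumLattice.expect (Matrix.conjTranspose X * X) (ψ L)).re / ((L : ℕ) : ℝ) ^ 4) ∧ Literature.Probability.LatticeModels.HasLongRangeOrder (fun k => Literature.Probability.LatticeModels.halfOpenBox 2 (2 * k)) (fun k => Literature.MathematicalPhysics.QuantumLattice.torusPullback (Literature.MathematicalPhysics.QuantumLattice.pairFieldCorr Literature.MathematicalPhysics.QuantumLattice.dWaveFormFactor ψ) (2 * k))) := by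
  rintro hPoint ⟨U₁, hU₁, hTransfer⟩ U₀ hU₀
  -- the construction point below both thresholds
  obtain ⟨U, hU, δ, hδ, μ, c, hc, hdens, hord, hchiral⟩ := hPoint (min U₀ U₁) (lt_min hU₀ hU₁)
  have hU0 : U ∈ Set.Ioo (0 : ℝ) U₀ := ⟨hU.1, lt_of_lt_of_le hU.2 (min_le_left _ _)⟩
  have hU1 : U ∈ Set.Ioo (0 : ℝ) U₁ := ⟨hU.1, lt_of_lt_of_le hU.2 (min_le_right _ _)⟩
  refine ⟨U, hU0, δ, hδ, c, hc, fun N ψ hyp => ⟨?_, ?_⟩⟩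
  · -- conjunct (i): pair-chirality LRO of every sector ground state = clause (c) of the point
    exact hchiral N ψ hyp
  · -- conjunct (ii): d-wave pair-field LRO through the Koma–Tasaki transfer at (U, δ, μ),
    -- fed with the point's density matching (a) and sourced d-wave order (b)
    exact hTransfer U hU1 δ hδ μ hdens hord N ψ hyp

end Summit.HubbardSuperconductivity.HubbardSuperconductivity.Theorems
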